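import Mathlib
import Summits.NavierStokesRegularity.NavierStokesRegularity.Theorems.ScaledTopAlignmentFlexibleZoomLU
import Summits.NavierStokesRegularity.NavierStokesRegularity.Theorems.ScaledTopAlignmentMostTimesEnd
import Summits.NavierStokesRegularity.NavierStokesRegularity.Theorems.LocalSineTubeDoorProfileAlignedWindowRigidity
import Summits.NavierStokesRegularity.NavierStokesRegularity.Theorems.ClockStretchingLawClockCeilingSingularStretchingNearZero
import Summits.NavierStokesRegularity.NavierStokesRegularity.Theorems.ScaledTopAlignmentDirectionGradientSelection
import Literature.Analysis.FluidPDE.VorticityCalculus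
import HarnessLib

/-!
# Route `ScaledTopAlignment`: Giga–Miura 2011, **Corollary 2.6** — a square-integrable-in-time `L^∞`
# bound on the gradient of the vorticity direction over the top region excludes Type-I blow-up —
# PROVED in the tree's Leray–Hopf frame (support for the deciding crux W3ᵐᵗ =
# `AprioriMostTimesBulkAlignment`, stmt-NavierStokesRegularity-19551; no import of the route file)

Source: Y. Giga, H. Miura, *On vorticity directions near singularities for the Navier–Stokes flows
with infinite energy*, Comm. Math. Phys. **303** (2011) 289–300 [GigaMiura2011], read in the
submitted text = Hokkaido University Preprint Series in Mathematics #956 (render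
`run/shared/lean/pub/ns-regularity-ideate/ns-regularity-ideate-lit/renders/GM11-HokkaidoPreprint956-full/`,
pp. 9–10; the render's subscript glyph `L1` is `L^∞`, see the render README's glyph caveat and
p. 10, l. 1–3: "This assumption [Beirão da Veiga–Berselli's `2/a + 3/b = 1/2`] is not scaling
invariant while ours is scaling invariant. It is easy to generalize our assumption in this form with
`2/a + 3/b = 1` and `2 ≤ a < ∞`" — the exponent pair of Cor. 2.6 is `(a, b) = (2, ∞)`).

* **Corollary 2.6** (p. 9, verbatim up to notation). "Let `u` be a type I mild solution of (NS)
  for `ℝ³ × (−1, 0)`. For a given `d > 0` assume that `∫_{−1}^{0} ‖∇ζ‖²_{L^∞(Ω_d(t))}(t) dt < +∞`,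
  where `Ω_d(t)` is defined as Theorem 1.1 [`Ω_d(t) = {x ∈ ℝ³ : |ω(x,t)| > d}`, `ζ = ω/|ω|`,
  `ω = curl u`]. Then `u` does not blow up at `t = 0`."
* **Remark 2.7** (p. 9): "Our assumption implies that `∇ζ` [of the blow-up limit] is identically
  zero. Hence `ζ` turns out to be a constant vector as in the proof of Proposition 2.2. Thus the
  proof is reduced to one of Theorem 1.1."

This is the one PRINTED member of the vorticity-direction family of regularity criteria whose
hypothesis is INTEGRATED IN TIME (so that `‖∇ζ(t)‖_{L^∞(Ω_d(t))}` may be unbounded on a sparse set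
of times) — the nearest print ancestor of the route's MOST-TIMES door W3ᵐᵗ (stmt-19551), which asks
for window-bulk alignment only off an exceptional time set of final density `< 1`.

## What is proved here

* `hasSmoothExtensionPast_of_directionGradient_sqIntegrable_typeI` — Cor. 2.6 in the frame of the
  tree's `Literature.Analysis.FluidPDE.gigaMiura_continuousAlignment_typeI` (GM11 Thm 1.1; the named
  Literature statement `Literature.Analysis.FluidPDE.gigaMiura2011_directionGradient_typeI` is this
  theorem's type and is discharged from it by name in a companion file): a
  classical solution on `ℝ³ × [0, T)`, Leray–Hopf from `u 0`, bounded on every `[0, T'] × ℝ³`,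
  Type I at `T` (`IsTypeIBlowup u T`); the printed hypothesis is rendered by a measurable
  majorant `g : ℝ → [0, ∞]` of `t ↦ ‖∇ξ(t)‖_{L^∞(Ω_d(t))}` with `∫_{(0,T)} g² < ∞`
  (`‖D ξ(t,·)(x)‖ₑ ≤ g t` whenever `|ω(t,x)| > d`, `ξ = vorticityDirection (curl (u t))`, operator
  norm of the Fréchet derivative; for the classical solutions of the frame the printed
  `t ↦ ‖∇ζ(t)‖_{L^∞(Ω_d(t))}` is itself such a `g` — it is lower semicontinuous, the sup of a
  jointly continuous quantity over an open `t`-dependent set — so the two readings agree);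
  conclusion `HasSmoothExtensionPast ν 0 u T`, as for Thm 1.1.
* `false_of_directionGradient_sqIntegrable_typeI` — the blow-up form: the hypotheses plus
  "no smooth extension past `T`" are contradictory — **Cor. 2.6 is PROVED**.

## The proof (Remark 2.7 made honest; the cell's Type-I zoom kit)

1. The flexible Type-I zoom with locally uniform slice convergence
   (`typeIZoom_ancientMild_limit_flexible_locUnif`): a non-trivial Type-I ancient mild limit `W`,
   `(λ_j²/ν) ω(T + λ_j² s/ν, x_j + λ_j y) → curl W(s)(y)` locally uniformly in `y`, every `s < 0`.
2. A non-unidirectional — in particular non-irrotational — vorticity END `s < t₁` of `W`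
   (`exists_end_curl_not_unidirectional`).
3. **Selection of an a.e. slice (new; companion module
   `ScaledTopAlignmentDirectionGradientSelection`, `exists_slice_frequently_lt_of_sqIntegrable`).**
   The zoomed direction fields `ζ_j(s, y) = ξ(T + λ_j² s/ν, x_j + λ_j y)` have
   `‖∇_y ζ_j(s, ·)‖ ≤ λ_j g(T + λ_j² s/ν) =: H_j(s)` on the zoomed top region, and by the affine
   substitution `t = T + λ_j² s/ν`, `∫_{(a,b)} H_j(s)² ds = ν ∫_{(T + λ_j² a/ν, T + λ_j² b/ν)} g(t)² dt → 0`
   (absolute continuity of the finite integral `∫_{(0,T)} g²`) — scaling invariance of the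
   hypothesis is exactly what makes the powers of `λ_j` cancel. Fatou gives `liminf_j H_j(s)² = 0`
   for a.e. `s ∈ (a, b) = (t₁ − 1, t₁)`, hence a slice `s₀ < t₁` with `H_j(s₀) < η` frequently in
   `j`, for every `η > 0`.
4. **Mean value on the zoomed direction field (new).** At `s₀` pick `y₀` with `curl W(s₀)(y₀) ≠ 0`
   and a closed ball `B̄(y₀, r)` on which `|curl W(s₀)| > ¾|curl W(s₀)(y₀)|`; by the locally uniform
   convergence the zoomed vorticities exceed `½|curl W(s₀)(y₀)| > d λ_j²/ν` on the ball for large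
   `j`, i.e. the ball's preimage lies in `Ω_d`, so `ζ_j(s₀, ·)` is differentiable there
   (`differentiableAt_vorticityDirection`) with `‖∇ζ_j‖ ≤ H_j(s₀)` (chain rule) and
   `|ζ_j(s₀,y) − ζ_j(s₀,y₀)| ≤ H_j(s₀) r`
   (`Convex.norm_image_sub_le_of_norm_fderiv_le`). Since `ζ_j(s₀, y) → curl W(s₀)(y)/|curl W(s₀)(y)|`
   and `H_j(s₀) < η` frequently, the limit directions agree on the ball: `curl W(s₀)` is parallel to
   `curl W(s₀)(y₀)` on `B(y₀, r)`.
5. LocalSineTubeDoor's window rigidity `eq_zero_of_aligned_window` (slice analyticity + identity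
   theorem + Giga–Miura's 2D reduction + KNSS planar Liouville) forces `W ≡ 0` — contradiction.

WHAT THIS IS NOT: not NS regularity — a Type-I-CONDITIONAL regularity criterion from print, now a
tree theorem; it does not prove the door W3ᵐᵗ (an a-priori statement about all Leray–Hopf flows) and
leaves the residual hard core NoTypeII (stmt-0056) untouched.

## References
* Y. Giga, H. Miura, Comm. Math. Phys. 303 (2011) 289–300 = HUPS #956: Cor. 2.6, Rmk. 2.7–2.8
  (pp. 9–10), Thm 1.1 (p. 3), §2.1 (pp. 5–9). [GigaMiura2011]
* G. Koch, N. Nadirashvili, G. Seregin, V. Šverák, Acta Math. 203 (2009) 83–105 = arXiv:0709.3599: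
  Prop. 4.1, Lemma 6.1, Thm 5.1, §6. [KochNadirashviliSereginSverak2009]
* H. Beirão da Veiga, L. C. Berselli, Differential Integral Equations 15 (2002) 345–356 (the
  `∇ξ ∈ L^a(L^b)`, `2/a + 3/b = 1/2` criterion quoted in Rmk. 2.8). [BeiraodaVeigaBerselli2002]
-/

noncomputable section

-- the summit and its single sub-problem share the name (CONVENTIONS §1), as in every Theorems file
set_option linter.dupNamespace false

open MeasureTheory Set Function Filter Topology Metric
open scoped RealInnerProductSpace ENNReal NNReal

namespace Summit.NavierStokesRegularity.NavierStokesRegularity.Theorems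

open Literature.Analysis Literature.Analysis.FluidPDE
open Summit.NavierStokesRegularity.NavierStokesRegularity.Theorems.LocalSineTubeDoorProfileAlignedWindowRigidity

/-! ### The blow-up form and Cor. 2.6 -/

set_option maxHeartbeats 800000 in
/-- **A square-integrable-in-time `L^∞(Ω_d)` bound on `∇ξ` kills Type-I blow-up** (blow-up form
of Giga–Miura 2011, Cor. 2.6). Let `(u, p)` be a classical solution on `ℝ³ × [0, T)`, Leray–Hopf
from `u 0`, bounded on every `[0, T'] × ℝ³` (`T' < T`), with the Type-I rate at `T` and no smooth
extension past `T`, and let `g : ℝ → [0,∞]` be measurable with `∫_{(0,T)} g² < ∞` and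
`‖D(ξ(t))(x)‖ₑ ≤ g t` whenever `t ∈ (0,T)` and `|ω(t,x)| > d` (`d > 0`). Then `False` (steps 1–5
of the module docstring). [cite: GigaMiura2011, Cor. 2.6 with Rmk. 2.7 (§2.1; HUPS preprint #956 p. 9)] -/
theorem false_of_directionGradient_sqIntegrable_typeI {ν T : ℝ} (hν : 0 < ν) (hT : 0 < T)
    {u : ℝ → EuclideanSpace ℝ (Fin 3) → EuclideanSpace ℝ (Fin 3)}
    {p : ℝ → EuclideanSpace ℝ (Fin 3) → ℝ}
    (hsol : IsClassicalNSSolutionOn (Ico 0 T) ν 0 u p) (hLH : IsLerayHopfOn T ν 0 (u 0) u)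
    (hslab : ∀ T' < T, ∃ M : ℝ, ∀ t ∈ Icc 0 T', ∀ x, ‖u t x‖ ≤ M)
    (hI : IsTypeIBlowup u T) (hext : ¬ HasSmoothExtensionPast ν 0 u T)
    {d : ℝ} (hd : 0 < d) {g : ℝ → ℝ≥0∞} (hgm : Measurable g)
    (hg2 : (∫⁻ t in Ioo 0 T, g t ^ 2) < ∞)
    (hDξ : ∀ t ∈ Ioo 0 T, ∀ x : EuclideanSpace ℝ (Fin 3), d < ‖curl (u t) x‖ →
      ‖fderiv ℝ (vorticityDirection (curl (u t))) x‖ₑ ≤ g t) : False := by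
  classical
  -- Step 1: the flexible zoom with locally uniform slice convergence, base times `τ_j = T - T/(j+2)`
  set τ : ℕ → ℝ := fun j => T - T / ((j : ℝ) + 2) with hτdef
  have hτ : ∀ j, τ j ∈ Ico 0 T := fun j => by
    have h2 : (0 : ℝ) < (j : ℝ) + 2 := by positivity
    have h3 : T / ((j : ℝ) + 2) ≤ T := by
      rw [div_le_iff₀ h2]; nlinarith [(Nat.cast_nonneg j : (0 : ℝ) ≤ j)]
    have h4 : 0 < T / ((j : ℝ) + 2) := div_pos hT h2
    simp only [hτdef, mem_Ico]
    constructor <;> linarith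
  have hτT : Tendsto τ atTop (𝓝 T) := by
    have h1 : Tendsto (fun j : ℕ => T / ((j : ℝ) + 2)) atTop (𝓝 0) := by
      have h := (tendsto_one_div_add_atTop_nhds_zero_nat (𝕜 := ℝ)).comp (tendsto_add_atTop_nat 1)
      have h' : Tendsto (fun j : ℕ => T * (1 / ((j : ℝ) + 2))) atTop (𝓝 (T * 0)) := by
        refine (h.congr fun j => ?_).const_mul T
        simp only [comp_apply, Nat.cast_add, Nat.cast_one]
        ring
      rw [mul_zero] at h'
      exact h'.congr fun j => by ring
    have h2 := h1.const_sub T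
    rw [sub_zero] at h2
    exact h2
  obtain ⟨φ, -, C, W, xc, lam, hWcl, hW0, hlam, -, hlam0, -, hflex, hLU⟩ :=
    typeIZoom_ancientMild_limit_flexible_locUnif hν hT hsol hLH hslab hI hext hτ hτT
  have hc : ∀ j, 0 < lam j ^ 2 / ν := fun j => div_pos (pow_pos (hlam j) 2) hν
  have hc0 : Tendsto (fun j => lam j ^ 2 / ν) atTop (𝓝 0) := by
    have h := (hlam0.pow 2).div_const ν
    rw [zero_pow two_ne_zero, zero_div] at h
    exact h
  -- Step 2: a non-unidirectional vorticity end `s < t₁` of `W`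
  obtain ⟨t₁, ht₁, hend⟩ := exists_end_curl_not_unidirectional hWcl ⟨-1, by norm_num, 0, hW0⟩
  have hnz : ∀ s < t₁, ∃ y, curl (W s) y ≠ 0 := by
    intro s hs
    by_contra h
    push Not at h
    have he1 : (EuclideanSpace.single (0 : Fin 3) (1 : ℝ) : EuclideanSpace ℝ (Fin 3)) ≠ 0 := by
      intro h0
      have := congr_arg (fun v : EuclideanSpace ℝ (Fin 3) => v 0) h0
      simp at this
    exact hend s hs ⟨EuclideanSpace.single 0 1, he1, fun y => ⟨0, by rw [h y, zero_smul]⟩⟩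
  -- Step 3: an a.e.-good slice `s₀ ∈ (t₁ - 1, t₁)`: the scaled direction-gradient majorants
  -- `λ_j g(T + λ_j² s₀/ν)` are `< η` frequently in `j`, for every `η > 0` (Fatou on the `L²` tail,
  -- `exists_slice_frequently_lt_of_sqIntegrable`)
  obtain ⟨s₀, hs₀mem, hfreq⟩ := exists_slice_frequently_lt_of_sqIntegrable (T := T) hν hT hgm hg2 hlam
    hlam0 (show t₁ - 1 < t₁ by linarith) ht₁
  have hs₀t₁ : s₀ < t₁ := hs₀mem.2
  have hs₀0 : s₀ < 0 := hs₀t₁.trans ht₁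
  set H : ℕ → ℝ≥0∞ := fun j => ENNReal.ofReal (lam j) * g (T + lam j ^ 2 / ν * s₀) with hHdef
  -- Step 4: the slice `s₀`: a ball on which the limit vorticity stays away from zero
  set Ω : EuclideanSpace ℝ (Fin 3) → EuclideanSpace ℝ (Fin 3) := curl (W s₀) with hΩdef
  obtain ⟨y₀, hy₀⟩ := hnz s₀ hs₀t₁
  have hΩc : Continuous Ω :=
    continuous_curl ((hWcl.contDiff_slice hs₀0).of_le (by exact_mod_cast le_top))
  set m₀ : ℝ := ‖Ω y₀‖ with hm₀def
  have hm₀ : 0 < m₀ := norm_pos_iff.2 hy₀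
  obtain ⟨r, hr, hball⟩ : ∃ r : ℝ, 0 < r ∧ ∀ y ∈ closedBall y₀ r, ‖Ω y - Ω y₀‖ < m₀ / 4 := by
    obtain ⟨δ, hδ, hδ'⟩ := Metric.continuousAt_iff.1 hΩc.continuousAt (m₀ / 4) (by positivity)
    refine ⟨δ / 2, by positivity, fun y hy => ?_⟩
    rw [← dist_eq_norm]
    exact hδ' (lt_of_le_of_lt (mem_closedBall.1 hy) (by linarith))
  have hΩne : ∀ y ∈ closedBall y₀ r, 3 * m₀ / 4 < ‖Ω y‖ := by
    intro y hy
    have h1 := hball y hy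
    have h2 : ‖Ω y₀‖ - ‖Ω y‖ ≤ ‖Ω y - Ω y₀‖ := by
      rw [← norm_neg (Ω y - Ω y₀), neg_sub]; exact norm_sub_norm_le _ _
    linarith
  have hΩne' : ∀ y ∈ closedBall y₀ r, Ω y ≠ 0 := fun y hy => by
    have := hΩne y hy
    exact norm_pos_iff.1 (by linarith)
  -- the vorticity zooms on the slice `s₀`, the physical times and the zoomed direction fields
  set F : ℕ → EuclideanSpace ℝ (Fin 3) → EuclideanSpace ℝ (Fin 3) := fun j y =>
    (lam j ^ 2 / ν) • curl (u (T + lam j ^ 2 * s₀ / ν)) (xc j + lam j • y) with hFdef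
  set tt : ℕ → ℝ := fun j => T + lam j ^ 2 * s₀ / ν with httdef
  have htt : ∀ j, T + lam j ^ 2 / ν * s₀ = tt j := fun j => by rw [httdef]; ring
  set ζ : ℕ → EuclideanSpace ℝ (Fin 3) → EuclideanSpace ℝ (Fin 3) := fun j y =>
    vorticityDirection (curl (u (tt j))) (xc j + lam j • y) with hζdef
  have hU : TendstoUniformlyOn F Ω atTop (closedBall y₀ r) :=
    (tendstoLocallyUniformly_iff_forall_isCompact.1 (hLU s₀ hs₀0)) _ (isCompact_closedBall _ _)
  have hev1 : ∀ᶠ j in atTop, ∀ y ∈ closedBall y₀ r, m₀ / 2 < ‖F j y‖ := by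
    filter_upwards [Metric.tendstoUniformlyOn_iff.1 hU (m₀ / 4) (by positivity)] with j hj y hy
    have h1 := hj y hy
    rw [dist_eq_norm] at h1
    have h2 := hΩne y hy
    have h3 : ‖Ω y‖ ≤ ‖Ω y - F j y‖ + ‖F j y‖ := by
      calc ‖Ω y‖ = ‖(Ω y - F j y) + F j y‖ := by rw [sub_add_cancel]
        _ ≤ ‖Ω y - F j y‖ + ‖F j y‖ := norm_add_le _ _
    linarith
  have hev2 : ∀ᶠ j in atTop, lam j ^ 2 / ν * d < m₀ / 2 := by
    have h1 : Tendsto (fun j => lam j ^ 2 / ν * d) atTop (𝓝 (0 * d)) := hc0.mul_const d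
    rw [zero_mul] at h1
    exact h1.eventually_lt_const (by positivity)
  have hev3 : ∀ᶠ j in atTop, tt j ∈ Ioo 0 T := by
    have h1 : Tendsto (fun j => lam j ^ 2 / ν * (-s₀)) atTop (𝓝 (0 * (-s₀))) := hc0.mul_const _
    rw [zero_mul] at h1
    filter_upwards [h1.eventually_lt_const hT] with j hj
    have h2 : lam j ^ 2 / ν * s₀ < 0 := mul_neg_of_pos_of_neg (hc j) hs₀0
    rw [← htt j]
    exact ⟨by linarith, by linarith⟩
  -- Step 5: on the good indices the zoomed direction field is `H j`-Lipschitz on the ball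
  have hgood : ∀ᶠ j in atTop, ∀ η : ℝ, H j < ENNReal.ofReal η →
      ∀ y ∈ closedBall y₀ r, ‖ζ j y - ζ j y₀‖ ≤ η * r := by
    filter_upwards [hev1, hev2, hev3] with j h1 h2 h3 η hH y hy
    -- `g (tt j)` is finite on a good index
    have hHj : H j = ENNReal.ofReal (lam j) * g (tt j) := by
      simp only [hHdef]; rw [htt j]
    have hlamj : ENNReal.ofReal (lam j) ≠ 0 := (ENNReal.ofReal_pos.2 (hlam j)).ne'
    have hgfin : g (tt j) ≠ ∞ := by
      intro htop
      rw [hHj, htop, ENNReal.mul_top hlamj] at hH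
      exact absurd hH (not_lt.2 le_top)
    have hη0 : (H j).toReal < η := ENNReal.toReal_lt_of_lt_ofReal hH
    have hHreal : (H j).toReal = lam j * (g (tt j)).toReal := by
      rw [hHj, ENNReal.toReal_mul, ENNReal.toReal_ofReal (hlam j).le]
    -- the ball's preimage lies in the top region `Ω_d(tt j)`
    have htop : ∀ z ∈ closedBall y₀ r, d < ‖curl (u (tt j)) (xc j + lam j • z)‖ := by
      intro z hz
      have hF := h1 z hz
      have e : ‖F j z‖ = lam j ^ 2 / ν * ‖curl (u (tt j)) (xc j + lam j • z)‖ := by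
        simp only [hFdef, httdef]
        rw [norm_smul, Real.norm_of_nonneg (hc j).le]
      rw [e] at hF
      exact lt_of_mul_lt_mul_left (h2.trans hF) (hc j).le
    -- differentiability of the direction field there, with the derivative bound
    have hmem : tt j ∈ Ico 0 T := ⟨h3.1.le, h3.2⟩
    have hωdiff : Differentiable ℝ (curl (u (tt j))) :=
      (contDiff_curl (n := 1) ((hsol.contDiff_velocity hmem).of_le (by exact_mod_cast le_top))).differentiable
        (by simp)
    have hξdiff : ∀ z ∈ closedBall y₀ r,
        DifferentiableAt ℝ (vorticityDirection (curl (u (tt j)))) (xc j + lam j • z) := fun z hz =>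
      differentiableAt_vorticityDirection (hωdiff _) (norm_pos_iff.1 (hd.trans (htop z hz)))
    have hξbd : ∀ z ∈ closedBall y₀ r,
        ‖fderiv ℝ (vorticityDirection (curl (u (tt j)))) (xc j + lam j • z)‖ ≤ (g (tt j)).toReal := by
      intro z hz
      have h := ENNReal.toReal_mono hgfin (hDξ (tt j) h3 _ (htop z hz))
      rwa [toReal_enorm] at h
    have hζder : ∀ z ∈ closedBall y₀ r, HasFDerivAt (ζ j)
        ((fderiv ℝ (vorticityDirection (curl (u (tt j)))) (xc j + lam j • z)).comp
          (lam j • ContinuousLinearMap.id ℝ (EuclideanSpace ℝ (Fin 3)))) z := by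
      intro z hz
      have haff : HasFDerivAt (fun y : EuclideanSpace ℝ (Fin 3) => xc j + lam j • y)
          (lam j • ContinuousLinearMap.id ℝ (EuclideanSpace ℝ (Fin 3))) z :=
        ((hasFDerivAt_id z).const_smul (lam j)).const_add (xc j)
      exact (hξdiff z hz).hasFDerivAt.comp z haff
    have hζbd : ∀ z ∈ closedBall y₀ r, ‖fderiv ℝ (ζ j) z‖ ≤ (g (tt j)).toReal * lam j := by
      intro z hz
      rw [(hζder z hz).fderiv]
      refine (ContinuousLinearMap.opNorm_comp_le _ _).trans ?_
      refine mul_le_mul (hξbd z hz) ?_ (norm_nonneg _) ENNReal.toReal_nonneg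
      rw [norm_smul, Real.norm_of_nonneg (hlam j).le]
      have := ContinuousLinearMap.norm_id_le (𝕜 := ℝ) (E := EuclideanSpace ℝ (Fin 3))
      nlinarith [(hlam j).le]
    -- mean value on the convex ball
    have hmv : ‖ζ j y - ζ j y₀‖ ≤ (g (tt j)).toReal * lam j * ‖y - y₀‖ :=
      (convex_closedBall y₀ r).norm_image_sub_le_of_norm_fderiv_le
        (fun z hz => (hζder z hz).differentiableAt) hζbd (mem_closedBall_self hr.le) hy
    have hyr : ‖y - y₀‖ ≤ r := by rw [← dist_eq_norm]; exact mem_closedBall.1 hy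
    have hC : (g (tt j)).toReal * lam j < η := by rw [mul_comm, ← hHreal]; exact hη0
    have hCnn : 0 ≤ (g (tt j)).toReal * lam j := mul_nonneg ENNReal.toReal_nonneg (hlam j).le
    calc ‖ζ j y - ζ j y₀‖ ≤ (g (tt j)).toReal * lam j * ‖y - y₀‖ := hmv
      _ ≤ (g (tt j)).toReal * lam j * r := mul_le_mul_of_nonneg_left hyr hCnn
      _ ≤ η * r := mul_le_mul_of_nonneg_right hC.le hr.le
  -- the zoomed directions converge to the direction of the limit vorticity on the ball
  have hζlim : ∀ y ∈ closedBall y₀ r, Tendsto (fun j => ζ j y) atTop (𝓝 (‖Ω y‖⁻¹ • Ω y)) := by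
    intro y hy
    have hconv : Tendsto (fun j => F j y) atTop (𝓝 (Ω y)) :=
      hflex s₀ hs₀0 (fun _ => s₀) tendsto_const_nhds y
    have hnd : ContinuousAt (fun v : EuclideanSpace ℝ (Fin 3) => ‖v‖⁻¹ • v) (Ω y) :=
      (continuous_norm.continuousAt.inv₀ (norm_ne_zero_iff.2 (hΩne' y hy))).smul continuousAt_id
    refine (hnd.tendsto.comp hconv).congr fun j => ?_
    show ‖F j y‖⁻¹ • F j y = ζ j y
    simp only [hFdef, hζdef, httdef, vorticityDirection_apply]
    exact inv_norm_smul_smul_of_pos (hc j) _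
  -- hence the limit directions agree on the ball
  have hpar : ∀ y ∈ closedBall y₀ r, ‖Ω y‖⁻¹ • Ω y = ‖Ω y₀‖⁻¹ • Ω y₀ := by
    intro y hy
    set D : ℝ := ‖‖Ω y‖⁻¹ • Ω y - ‖Ω y₀‖⁻¹ • Ω y₀‖ with hDdef
    have hDlim : Tendsto (fun j => ‖ζ j y - ζ j y₀‖) atTop (𝓝 D) :=
      ((hζlim y hy).sub (hζlim y₀ (mem_closedBall_self hr.le))).norm
    have hDle : ∀ η : ℝ, 0 < η → D ≤ η * r := by
      intro η hη
      by_contra hlt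
      push Not at hlt
      have hev : ∀ᶠ j in atTop, η * r < ‖ζ j y - ζ j y₀‖ := hDlim.eventually (lt_mem_nhds hlt)
      obtain ⟨j, hj1, hj2, hj3⟩ := ((hfreq η hη).and_eventually (hgood.and hev)).exists
      exact absurd (hj2 η hj1 y hy) (not_le.2 hj3)
    have hD0 : D ≤ 0 := by
      by_contra hpos
      push Not at hpos
      have h := hDle (D / (2 * r)) (by positivity)
      have e : D / (2 * r) * r = D / 2 := by field_simp
      linarith
    have hD00 : D = 0 := le_antisymm hD0 (norm_nonneg _)
    exact sub_eq_zero.1 (norm_eq_zero.1 hD00)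
  -- Step 6: `curl W(s₀)` is parallel to `Ω y₀` on the open ball — window rigidity kills `W`
  have hal : ∀ y ∈ ball y₀ r, cross (curl (W s₀) y) (Ω y₀) = 0 := by
    intro y hy
    have hy' : y ∈ closedBall y₀ r := ball_subset_closedBall hy
    have hΩy : Ω y ≠ 0 := hΩne' y hy'
    have e1 : Ω y = (‖Ω y‖ * ‖Ω y₀‖⁻¹) • Ω y₀ := by
      calc Ω y = ‖Ω y‖ • (‖Ω y‖⁻¹ • Ω y) := by rw [smul_inv_smul₀ (norm_ne_zero_iff.2 hΩy)]
        _ = ‖Ω y‖ • (‖Ω y₀‖⁻¹ • Ω y₀) := by rw [hpar y hy']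
        _ = (‖Ω y‖ * ‖Ω y₀‖⁻¹) • Ω y₀ := by rw [mul_smul]
    show cross (Ω y) (Ω y₀) = 0
    rw [e1]
    ext i
    fin_cases i <;> (simp [cross]; try ring)
  exact hW0 (eq_zero_of_aligned_window hWcl.hasTypeITimeDecay hWcl.continuousOn_uncurry
    (fun s t hst ht' x => hWcl.mild_eq_heatExtension hst ht' x) (fun t ht' => hWcl.isDivFree ht')
    hs₀0 hy₀ isOpen_ball ⟨y₀, mem_ball_self hr⟩ hal (-1) (by norm_num) 0)

/-- **Giga–Miura 2011, Corollary 2.6 — PROVED** (explicit form; the named Literature statement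
`Literature.Analysis.FluidPDE.gigaMiura2011_directionGradient_typeI` is discharged from this by name).
Let `ν > 0`, `T > 0`, and let `(u, p)` be a classical unforced Navier–Stokes solution on
`ℝ³ × [0, T)` which is Leray–Hopf on `[0, T)` and bounded on `ℝ³ × [0, T']` for every `T' < T`, with
a possible blow-up at `T` of Type I (`IsTypeIBlowup u T`). If for some `d > 0` the function
`t ↦ ‖∇ξ(t)‖_{L^∞(Ω_d(t))}` (`Ω_d(t) = {x : |ω(x,t)| > d}`, `ξ = ω/|ω|`) admits a measurable
majorant `g : ℝ → [0, ∞]` with `∫_{(0,T)} g² < ∞` (`‖D(ξ(t))(x)‖ₑ ≤ g t` whenever `t ∈ (0, T)`,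
`|ω(t,x)| > d`), then `u` continues as a classical solution past `T`. Printed for Type I mild
solutions on `ℝ³ × (−1, 0)`, `ν = 1`, hypothesis `∫_{−1}^{0} ‖∇ζ‖²_{L^∞(Ω_d(t))} dt < +∞`.
[cite: GigaMiura2011, Cor. 2.6 with Rmk. 2.7 (§2.1; HUPS preprint #956 p. 9)] -/
theorem hasSmoothExtensionPast_of_directionGradient_sqIntegrable_typeI {ν T : ℝ} (hν : 0 < ν)
    (hT : 0 < T) {u : ℝ → EuclideanSpace ℝ (Fin 3) → EuclideanSpace ℝ (Fin 3)}
    {p : ℝ → EuclideanSpace ℝ (Fin 3) → ℝ}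
    (hsol : IsClassicalNSSolutionOn (Ico 0 T) ν 0 u p) (hLH : IsLerayHopfOn T ν 0 (u 0) u)
    (hbdd : ∀ T' < T, ∃ M : ℝ, ∀ t ∈ Icc 0 T', ∀ x, ‖u t x‖ ≤ M)
    (hI : IsTypeIBlowup u T)
    (hD : ∃ d : ℝ, 0 < d ∧ ∃ g : ℝ → ℝ≥0∞, Measurable g ∧ (∫⁻ t in Ioo 0 T, g t ^ 2) < ∞ ∧
      ∀ t ∈ Ioo 0 T, ∀ x : EuclideanSpace ℝ (Fin 3), d < ‖curl (u t) x‖ →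
        ‖fderiv ℝ (vorticityDirection (curl (u t))) x‖ₑ ≤ g t) :
    HasSmoothExtensionPast ν 0 u T := by
  obtain ⟨d, hd, g, hgm, hg2, hDξ⟩ := hD
  by_contra hext
  exact false_of_directionGradient_sqIntegrable_typeI hν hT hsol hLH hbdd hI hext hd hgm hg2 hDξ

end Summit.NavierStokesRegularity.NavierStokesRegularity.Theorems

end
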